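import Summits.QuantumFields.BalabanUV.Beta.SpineRecursiveT2AllAntiTwin
import Summits.QuantumFields.BalabanUV.Beta.WilsonReflectionContact2
import Summits.QuantumFields.BalabanUV.Beta.MixedJetTablesPlug

/-!
# `BalabanUV.Beta.SpineRecursiveT2AllSockets` — binder row D1, (L4): **hR FOR THE RECURSIVE WALL LITERAL ⟸ an1's TWO LETTERS ONLY** — the
# Wilson letter DISCHARGED (an3-g32's `WilsonReflectionContact2.wilsonW₂_bref_ff_canon_bhKAt` at the table `T_W := (8N²)⁻¹ • wsym22 N`,
# `RW := 0`), the mixed table INSTANTIATED at an1's `mixFFAt ρ_c Lc` (`MixedJetTablesPlug.hmix_an1`/`hmixt_an1`), the border socket in its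
# satisfiable ANTI-TWIN form (`SpineRecursiveT2AllAntiTwin`) (β sub-cell, row BETA-an2 = BINDER-OWNERS row D1 OWNER, lineage an2 gen 19)

HONEST FRAMING (cell charter, verbatim): «discharging BetaPertH makes Balaban's UV stability UNCONDITIONAL — a real
constructive-QFT result; it is NOT the continuum limit and NOT the Clay problem.»  DERIVED cell leaf (wiring, [folklore]); no statement of
Bałaban's papers, no `[cite:]`, no `def`, no `Prop` fact.  The BORDER and MIXED letters remain hypotheses (an1's (W-0B) / (W-LET-M₂)); the
border table `vh₂S` is free (anti-twin; an1's repacked second-order border table — X-an2-46).  NOT D1, NOT `BetaPertH`, NOT continuum, NOT Clay.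

**`axisReflectionCovariant_flipK_TbalOf_JsRecWAtOf_of_an1_letters`**: for colour data `(τ, hτ, ho, hN, c)` (an orthonormal complete traceless
basis, e.g. `ColourTrace.pauli` at `N = 2`), coefficients `cΛ cE₂ cB` with the lock `hlock2` (⟺ `cE₂ = Lc⁸`), an ANTI-TWIN border table `vh₂S`
(`LocStencil₂`, no `ff`/`mm` block, block-covariant), and the wall's `γ`:
`∀ j, AxisReflectionCovariant (flipK (TbalOf Lc (JsRecWAtOf … cΛ cE₂ cB T_W …) j))` ⟸ EXACTLY
(hBe) the border law ∀ j ≥ 0 (one exact `fm`-entrywise identity, canonical second symbol, no residual) ∧ (hM2) the mixed law ∀ j for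
`M2Of 3 Lc (mixFFAt ρ_c Lc) j` with an odd `LocStencilFM` residual `RM`.
Provenance: β sub-cell, unit beta-an2 gen 19, 2026-08-20 (v1); no existing file touched.
-/

open Finset
open scoped BigOperators
open Literature.MathematicalPhysics.QuantumFieldTheory
open Literature.MathematicalPhysics.QuantumFieldTheory.Balaban1983to89
open Literature.MathematicalPhysics.QuantumFieldTheory.Balaban1983to89.Beta
open ExpKernelCalculus (MKer Decays BiLoc comp tadpole VertexFamily VertexFamily₂ shiftK)
open AffineAveraging (box toSite)
open AveragingContoursRooted (ctr ctrOff ctrOff_mem_box)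
open AveragingMixedJetTables (mixFFAt)
open PolarizationSign (reflSign AxisReflectionCovariant)
open KernelReflection (refK refK_apply)
open ResolventReflection (bref Φ)
open OneStepResolventKernel (Fib LocStencil JetData wsum)
open OneStepKernelFamily (KInvStep colH vertexOfK TbalOf flipK)
open ColourTrace (Complete TrOrthonormal pauli pauli_complete pauli_trOrthonormal)
open WilsonVertex2Sym (wsym22)
open StepJetData (wilsonA)
open WilsonBiStencil (wilsonW₂)
open HessKerRate (biLoc_zero)
open BalabanStepJetsSucc (wE wVH mmRead)
open BalabanCompositeJets (LocStencil₂)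
open BalabanStepW2 (M2Of wV4 wB2)
open SecondOrderResponse (dM W2OfK W2SymOfK LocStencilFM vertex2OfK mixOfK K2OfK)
open Summit.QuantumFields.BalabanUV.Beta.TameKernelCalculus
open Summit.QuantumFields.BalabanUV.Beta.ChartConjugation (conjV conjW)
open Summit.QuantumFields.BalabanUV.Beta.AxialDressingRooted (coDressKBmAt)
open Summit.QuantumFields.BalabanUV.Beta.BorderedHessian (diagK ctGen bhKStepAt bhKStepAt_zero stepScale sgnK)
open Summit.QuantumFields.BalabanUV.Beta.WardLocusCubic (mmSym)
open Summit.QuantumFields.BalabanUV.Beta.SpineRecursiveParity (parityOdd_zero)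
open Summit.QuantumFields.BalabanUV.Beta.WilsonReflectionContact2 (wilsonW₂_bref_ff_canon_bhKAt)
open Summit.QuantumFields.BalabanUV.Beta.MixedJetTablesPlug (hmix_an1 hmixt_an1)

noncomputable section

namespace Summit.QuantumFields.BalabanUV.Beta.SpineRooted

section Wall

variable {Lc : ℕ} [NeZero Lc]

/-- [folklore] **hR(v2.26-W, T := (8N²)⁻¹•wsym22 N, mixFF := mixFFAt ρ_c Lc) ⟸ an1's BORDER LAW (anti-twin, exact) AND MIXED LAW ONLY**
(+ residual class of `RM`, lock2, the border table's data). -/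
theorem axisReflectionCovariant_flipK_TbalOf_JsRecWAtOf_of_an1_letters (hLc : Odd Lc) {N : ℕ} {C : Type*} [Fintype C] [DecidableEq C]
    {τ : C → Matrix (Fin N) (Fin N) ℂ} (hτ : Complete τ) (ho : TrOrthonormal τ) (hN : N ≠ 0) (c : C) (cΛ cE₂ cB : ℝ)
    {vh₂S : Fin 4 → (Fin 4 → ℤ) → Fin 4 → (Fin 4 → ℤ) → MKer 4 (Fib 3)} (hB : ∃ C δ : ℝ, 0 < δ ∧ LocStencil₂ vh₂S C δ)
    (hB0 : ∀ κ u κ' u' (x z : Fin 4 → ℤ) (β β' : Fin 4), vh₂S κ u κ' u' x z (Sum.inl β) (Sum.inl β') = 0)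
    (γ : ℕ → ℝ) (hγ : ∀ j, γ j = -((Lc : ℝ) ^ 8 / 2) * wVH 3 Lc j / (stepScale 3 Lc j * (Lc : ℝ) ^ 4))
    (hlock2 : ∀ j, cE₂ * wV4 3 Lc (j + 1) * wVH 3 Lc (j + 1) = ((Lc : ℝ) ^ 4 * wE 3 Lc (j + 1)) ^ 2)
    (RM : ℕ → Fin 4 → Fin 4 → (Fin 4 → ℤ) → Fin 4 → (Fin 4 → ℤ) → MKer 4 (Fib 3))
    -- (hM2) THE MIXED LETTER ∀ j
    (hM2 : ∀ (j : ℕ) (α κ : Fin 4) (u : Fin 4 → ℤ) (ρ : Fin 4) (w : Fin 4 → ℤ),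
      M2Of 3 Lc (mixFFAt (toSite (ctrOff 4 Lc)) Lc) j κ (bref α κ u) ρ (bref α ρ w) =
        (reflSign α κ * reflSign α ρ) • refK (Φ Lc α)
          (M2Of 3 Lc (mixFFAt (toSite (ctrOff 4 Lc)) Lc) j κ u ρ w + conjV (M1At 3 Lc (toSite (ctrOff 4 Lc)) cΛ j ρ w) (diagK fun p c => γ j * ctGen 3 α Lc κ u p c) +
            RM j α κ u ρ w))
    (hRMc : ∀ (j : ℕ) (α : Fin 4), ∃ C δ : ℝ, 0 < δ ∧ LocStencilFM Lc (RM j α) C δ)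
    (hRMp : ∀ (j : ℕ) (α : Fin 4) κ u ρ w, trK (RM j α κ u ρ w) = -sgnK (RM j α κ u ρ w))
    -- THE BORDER TABLE IS ANTI-TWIN (parity-even) WITH NO mm BLOCK, AND ITS LETTER IS ONE EXACT fm-LAW ∀ j ≥ 0 (X-an2-46)
    (hBat : ∀ κ u κ' u' (x z : Fin 4 → ℤ) (β m : Fin 4), vh₂S κ u κ' u' z x (Sum.inr m) (Sum.inl β) = -vh₂S κ u κ' u' x z (Sum.inl β) (Sum.inr m))
    (hBmm0 : ∀ κ u κ' u' (x z : Fin 4 → ℤ) (m m' : Fin 4), vh₂S κ u κ' u' x z (Sum.inr m) (Sum.inr m') = 0)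
    (hBe : ∀ (j : ℕ) (α : Fin 4) κ u κ' u' (x z : Fin 4 → ℤ) (β m : Fin 4),
      ((cB * wB2 3 Lc j) • vh₂S κ (bref α κ u) κ' (bref α κ' u')) x z (Sum.inl β) (Sum.inr m) =
        ((reflSign α κ * reflSign α κ') • refK (Φ Lc α) ((cB * wB2 3 Lc j) • vh₂S κ u κ' u' +
          conjW (bhKStepAt 3 (toSite (ctrOff 4 Lc)) Lc j)
            (SpureRecAt 3 Lc (toSite (ctrOff 4 Lc)) ((Lc : ℝ) ^ 4) (-((Lc : ℝ) ^ 8 / 2)) cΛ j κ u)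
            (SpureRecAt 3 Lc (toSite (ctrOff 4 Lc)) ((Lc : ℝ) ^ 4) (-((Lc : ℝ) ^ 8 / 2)) cΛ j κ' u')
            (diagK fun p c => γ j * ctGen 3 α Lc κ u p c) (diagK fun p c => γ j * ctGen 3 α Lc κ' u' p c)
            (diagK fun p c => γ j ^ 2 * (ctGen 3 α Lc κ u p c * ctGen 3 α Lc κ' u' p c)))) x z (Sum.inl β) (Sum.inr m))
    (hBt : ∀ (κ : Fin 4) (u : Fin 4 → ℤ) (κ' : Fin 4) (u' t : Fin 4 → ℤ),
      vh₂S κ (u + (Lc : ℤ) • t) κ' (u' + (Lc : ℤ) • t) = shiftK (-((Lc : ℤ) • t)) (vh₂S κ u κ' u'))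
    :
    ∀ j : ℕ, AxisReflectionCovariant
      (flipK (TbalOf Lc (JsRecWAtOf (d := 3) hLc.pos (ctrOff_mem_box hLc.pos) ((Lc : ℝ) ^ 4) (-((Lc : ℝ) ^ 8 / 2)) cΛ cE₂ cB ((8 * (N : ℝ) ^ 2)⁻¹ • wsym22 N) hB
        (hmix_an1 (d := 3) hLc.pos (ctrOff_mem_box hLc.pos))) j)) :=
  axisReflectionCovariant_flipK_TbalOf_JsRecWAtOf_of_letters_antiTwin hLc cΛ cE₂ cB ((8 * (N : ℝ) ^ 2)⁻¹ • wsym22 N) hB hB0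
    (hmix_an1 (d := 3) hLc.pos (ctrOff_mem_box hLc.pos)) γ hγ hlock2 RM (fun _ _ _ _ _ => 0)
    (fun α κ u κ' u' x z β β' => by
      simpa only [Pi.zero_apply, add_zero, bhKStepAt_zero] using
        wilsonW₂_bref_ff_canon_bhKAt (d := 3) hτ ho hN c (toSite (ctrOff 4 Lc)) Lc Lc α κ κ' u u' x z β β')
    (fun _ _ _ _ _ _ _ _ _ => rfl) (fun _ _ _ _ _ _ _ _ _ => rfl)
    (fun _ => ⟨0, 1, one_pos, fun κ u κ' u' => by simpa using (biLoc_zero u u (1 : ℝ) : BiLoc (0 : MKer 4 (Fib 3)) u u 0 1)⟩)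
    (fun _ _ _ _ _ => parityOdd_zero) hM2 hRMc hRMp hBat hBmm0 hBe hBt (hmixt_an1 (toSite (ctrOff 4 Lc)))

/-- [folklore] **THE `SU(2)` INSTANCE** (colour basis := `ColourTrace.pauli`). -/
theorem axisReflectionCovariant_flipK_TbalOf_JsRecWAtOf_of_an1_letters_su2 (hLc : Odd Lc) (cΛ cE₂ cB : ℝ)
    {vh₂S : Fin 4 → (Fin 4 → ℤ) → Fin 4 → (Fin 4 → ℤ) → MKer 4 (Fib 3)} (hB : ∃ C δ : ℝ, 0 < δ ∧ LocStencil₂ vh₂S C δ)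
    (hB0 : ∀ κ u κ' u' (x z : Fin 4 → ℤ) (β β' : Fin 4), vh₂S κ u κ' u' x z (Sum.inl β) (Sum.inl β') = 0)
    (γ : ℕ → ℝ) (hγ : ∀ j, γ j = -((Lc : ℝ) ^ 8 / 2) * wVH 3 Lc j / (stepScale 3 Lc j * (Lc : ℝ) ^ 4))
    (hlock2 : ∀ j, cE₂ * wV4 3 Lc (j + 1) * wVH 3 Lc (j + 1) = ((Lc : ℝ) ^ 4 * wE 3 Lc (j + 1)) ^ 2)
    (RM : ℕ → Fin 4 → Fin 4 → (Fin 4 → ℤ) → Fin 4 → (Fin 4 → ℤ) → MKer 4 (Fib 3))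
    -- (hM2) THE MIXED LETTER ∀ j
    (hM2 : ∀ (j : ℕ) (α κ : Fin 4) (u : Fin 4 → ℤ) (ρ : Fin 4) (w : Fin 4 → ℤ),
      M2Of 3 Lc (mixFFAt (toSite (ctrOff 4 Lc)) Lc) j κ (bref α κ u) ρ (bref α ρ w) =
        (reflSign α κ * reflSign α ρ) • refK (Φ Lc α)
          (M2Of 3 Lc (mixFFAt (toSite (ctrOff 4 Lc)) Lc) j κ u ρ w + conjV (M1At 3 Lc (toSite (ctrOff 4 Lc)) cΛ j ρ w) (diagK fun p c => γ j * ctGen 3 α Lc κ u p c) +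
            RM j α κ u ρ w))
    (hRMc : ∀ (j : ℕ) (α : Fin 4), ∃ C δ : ℝ, 0 < δ ∧ LocStencilFM Lc (RM j α) C δ)
    (hRMp : ∀ (j : ℕ) (α : Fin 4) κ u ρ w, trK (RM j α κ u ρ w) = -sgnK (RM j α κ u ρ w))
    -- THE BORDER TABLE IS ANTI-TWIN (parity-even) WITH NO mm BLOCK, AND ITS LETTER IS ONE EXACT fm-LAW ∀ j ≥ 0 (X-an2-46)
    (hBat : ∀ κ u κ' u' (x z : Fin 4 → ℤ) (β m : Fin 4), vh₂S κ u κ' u' z x (Sum.inr m) (Sum.inl β) = -vh₂S κ u κ' u' x z (Sum.inl β) (Sum.inr m))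
    (hBmm0 : ∀ κ u κ' u' (x z : Fin 4 → ℤ) (m m' : Fin 4), vh₂S κ u κ' u' x z (Sum.inr m) (Sum.inr m') = 0)
    (hBe : ∀ (j : ℕ) (α : Fin 4) κ u κ' u' (x z : Fin 4 → ℤ) (β m : Fin 4),
      ((cB * wB2 3 Lc j) • vh₂S κ (bref α κ u) κ' (bref α κ' u')) x z (Sum.inl β) (Sum.inr m) =
        ((reflSign α κ * reflSign α κ') • refK (Φ Lc α) ((cB * wB2 3 Lc j) • vh₂S κ u κ' u' +
          conjW (bhKStepAt 3 (toSite (ctrOff 4 Lc)) Lc j)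
            (SpureRecAt 3 Lc (toSite (ctrOff 4 Lc)) ((Lc : ℝ) ^ 4) (-((Lc : ℝ) ^ 8 / 2)) cΛ j κ u)
            (SpureRecAt 3 Lc (toSite (ctrOff 4 Lc)) ((Lc : ℝ) ^ 4) (-((Lc : ℝ) ^ 8 / 2)) cΛ j κ' u')
            (diagK fun p c => γ j * ctGen 3 α Lc κ u p c) (diagK fun p c => γ j * ctGen 3 α Lc κ' u' p c)
            (diagK fun p c => γ j ^ 2 * (ctGen 3 α Lc κ u p c * ctGen 3 α Lc κ' u' p c)))) x z (Sum.inl β) (Sum.inr m))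
    (hBt : ∀ (κ : Fin 4) (u : Fin 4 → ℤ) (κ' : Fin 4) (u' t : Fin 4 → ℤ),
      vh₂S κ (u + (Lc : ℤ) • t) κ' (u' + (Lc : ℤ) • t) = shiftK (-((Lc : ℤ) • t)) (vh₂S κ u κ' u'))
    :
    ∀ j : ℕ, AxisReflectionCovariant
      (flipK (TbalOf Lc (JsRecWAtOf (d := 3) hLc.pos (ctrOff_mem_box hLc.pos) ((Lc : ℝ) ^ 4) (-((Lc : ℝ) ^ 8 / 2)) cΛ cE₂ cB ((8 * (2 : ℝ) ^ 2)⁻¹ • wsym22 2) hB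
        (hmix_an1 (d := 3) hLc.pos (ctrOff_mem_box hLc.pos))) j)) :=
  axisReflectionCovariant_flipK_TbalOf_JsRecWAtOf_of_an1_letters hLc pauli_complete pauli_trOrthonormal two_ne_zero (0 : Fin 3) cΛ cE₂ cB hB hB0 γ hγ
    hlock2 RM hM2 hRMc hRMp hBat hBmm0 hBe hBt

end Wall

end Summit.QuantumFields.BalabanUV.Beta.SpineRooted

end
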